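import Literature.MathematicalPhysics.QuantumFieldTheory.Balaban1983to89.Beta.RootedComb
import Literature.MathematicalPhysics.QuantumFieldTheory.Balaban1983to89.Beta.AveragingMixedJetTables

/-!
# `BalabanUV.Beta.RootedHolonomyReflection` — axis reflections transported through node 12's free letter group, part 1:
# the signed pull-back `R1g` with ARBITRARY coefficients and the letter reflection `refL`
# (β sub-cell, row BETA-an1, gen 28; module M1a of the letter-law plan «(W-LET-M₂) = (W-0B)», typer LEAVES row HR-W-LET)

HONEST FRAMING (cell charter, verbatim): «discharging BetaPertH makes Balaban's UV stability UNCONDITIONAL — a real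
constructive-QFT result; it is NOT the continuum limit and NOT the Clay problem.»  HONEST DEPENDENCY: continuum YM on T⁴ ⇐
BetaPertH ∧ nine spine estimates (0/9 proved); BetaPertH ⇐ (D1) ∧ (D4) ∧ CAP+tail; G-an2-4 gates asym, D1 and NE2/3/4.
DERIVED cell leaf (pub-balaban β sub-cell, lane an1 gen 28): [folklore] lattice combinatorics and ring algebra over an1's
nodes 5ρ/12/12b and an5's `RootedComb`, all imported BY NAME; no statement of Bałaban's papers is typed here, no `[cite:]`
tag, no `Prop` fact is minted, no binder of the β-function wall (`hW`/`hR`/`D1Tel`/`D1Rep`, (D1), `BetaPertH`) is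
instantiated or discharged.  NOT summit progress.

## What this module is for

The second-order Ward identity (W) of the β-wall's (D1) needs the reflection laws of the LETTERS of an2's recursive
kernel, among them node 12b's mixed one-step tables `mixFFAt` / `vh₂SAt` ((W-LET-M₂)/(W-LET-S₂), an2's sockets `(hM2)`,
`hBfm`).  Those tables are coefficients of `logT (Φ^ρ_b(…) · Φ^ρ_b(…)⁻¹)` for node 12b's rooted averaging `PhiGAt ρ` of
transporter pairs read along node 5ρ's centred contour LISTS over the universal one-form `δ : Form1 d (LetterGrp d)`.
an5's `RootedComb` §2/§5 transports those lists under the signed pull-back `R1 α` — but `R1` is typed for REAL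
coefficients (`reflSign α κ * A κ (bref α κ x)`), while the letters live in the free abelian group `LetterGrp d`.  This
module supplies the coefficient-generic transport; the sequel `RootedHolonomyReflectionHol` pushes it through node 12's
holonomy `holG` and the averaging `PhiGAt`:

* §1 `R1g α A κ x = ±A κ (bref α κ x)` (sign `−` iff `κ = α`) for `A : Form1 d R`, `R` any `AddCommGroup`, and the
  transport of node 5/5ρ's primitives VERBATIM from an5's `RootedComb` §2/§5 with `R1 ↦ R1g`: `segUp_R1g_of_ne/_self`,
  `segDown_R1g_of_ne/_self`, `seg_R1g`, `axialAux_R1g`, `axial_R1g`, `gammaCAt_R1g_of_ne/_self`,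
  `loopCAt_R1g_of_ne`, `loopCAt_R1g_self'` (the longitudinal image loop written as `rev Γ′ ++ c′`), `loopCAt_R1g_self`.
* §2 THE LETTER REFLECTION `refL α : LetterGrp d →+ LetterGrp d`, `δ_{(κ,x)} ↦ ±δ_{(κ, bref α κ x)}`;
  `mapForm (refL α) δ = R1g α δ`, hence the centred contour lists of `δ` are mapped by `refL α` onto the centred
  contour lists at the reflected bond (`map_refL_loopCAt_of_ne`, `map_refL_cSeg_of_ne`, `map_refL_cSeg_self`,
  `map_refL_loopCAt_self`) — `L` odd, root `ctr d L` (an5's (F0⁺) `sref_root_ctr`).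

## What is NOT here
No holonomy, no jet, no table, no kernel: nothing about `mixFFAt`/`hessFFAt`/`(hM2)` is proved in this file (evidence
for the corrected letter laws is the seat's exact-arithmetic toy, journal l.11301 — NOT a theorem).  No new contour object
is defined (node 5ρ's lists by name); an5's real-coefficient `R1` lemmas are neither re-proved nor generalised in place
(one-writer rule) — `R1g` is a separate generic-coefficient twin, and `R1g_eq_R1` records that on `Form1 d ℝ` they agree.
-/

namespace Summit.QuantumFields.BalabanUV.Beta.RootedHolonomyReflection

open Finset
open scoped BigOperators
open Literature.MathematicalPhysics.QuantumFieldTheory.Balaban1983to89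
open Literature.MathematicalPhysics.QuantumFieldTheory.Balaban1983to89.Beta
open AffineAveraging (Form0 Form1 unitVec unitVec_apply box toSite)
open AveragingContours (shift segUp segDown seg rev corner axialAux axial segUp_length)
open AveragingContoursRooted (gammaCAt loopCAt ctrOff ctr ctr_apply ctrOff_mem_box)
open TransportedContourVariables (mapForm mapForm_apply segUp_map rev_map)
open AveragingHessianKernels (LettersIn)
open AveragingHessianKernelsRooted (gammaCAt_map loopCAt_map)
open AveragingThirdJet (LetterGrp δ realize realize_delta realize_neg_delta holG holG_nil holG_cons holG_append expT logT)
open AveragingMixedJetTables (PhiGAt lettersIn_segUp_top lettersIn_gammaCAt_top lettersIn_loopCAt_top)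
open PolarizationSign (axisReflect axisReflect_apply reflSign)
open ResolventReflection (sref sref_apply sref_add sref_sub bref bref_apply bref_of_ne bref_self R1 R1_apply bflip
  bflip_mem mem_box sref_block toSite_bflip sum_box_bflip reflSign_self reflSign_of_ne axisReflect_zsmul
  axisReflect_unitVec_of_ne axisReflect_unitVec_self)
open RootedComb (corner_sref segUp_succ' rev_cons segDown_eq_rev_segUp sref_root_ctr rev_append rev_rev
  rotate_append_of_length_eq)

variable {d : ℕ}

/-! ## §1 The signed pull-back with arbitrary coefficients and the transport of the contour primitives -/

section Generic

variable {R : Type*} [AddCommGroup R]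

/-- [folklore] THE SIGNED PULL-BACK of a 1-form with coefficients in any additive group under the block-compatible axis
reflection: `(R1g α A)_κ(x) = ± A_κ(bref α κ x)`, sign `−` exactly on the reflected axis. -/
def R1g (α : Fin d) (A : Form1 d R) : Form1 d R := fun κ x => if κ = α then -A κ (bref α κ x) else A κ (bref α κ x)

/-- [folklore] Off the axis: `(R1g α A)_κ(x) = A_κ(sref α x)`. -/
theorem R1g_of_ne {α κ : Fin d} (h : κ ≠ α) (A : Form1 d R) (x : Fin d → ℤ) : R1g α A κ x = A κ (sref α x) := by
  rw [R1g, if_neg h, bref_of_ne h]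

/-- [folklore] On the axis: `(R1g α A)_α(x) = −A_α(sref α x − e_α)`. -/
theorem R1g_self (α : Fin d) (A : Form1 d R) (x : Fin d → ℤ) : R1g α A α x = -A α (sref α x - unitVec α) := by
  rw [R1g, if_pos rfl, bref_self]

/-- [folklore] On real 1-forms the generic pull-back IS an5/an2's `R1`. -/
theorem R1g_eq_R1 (α : Fin d) (A : Form1 d ℝ) : R1g α A = R1 α A := by
  funext κ x
  by_cases h : κ = α
  · subst h; rw [R1g, if_pos rfl, R1_apply, reflSign_self, neg_one_mul]
  · rw [R1g, if_neg h, R1_apply, reflSign_of_ne h, one_mul]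

/-- [folklore] A straight segment of the pulled-back form across the axis (an5's `segUp_R1_of_ne`, generic coefficients). -/
theorem segUp_R1g_of_ne {α κ : Fin d} (h : κ ≠ α) (A : Form1 d R) (z : Fin d → ℤ) (n : ℕ) :
    segUp (R1g α A) z κ n = segUp A (sref α z) κ n := by
  simp only [segUp, R1g_of_ne h, sref_add, axisReflect_zsmul, axisReflect_unitVec_of_ne h]

/-- [folklore] A straight segment of the pulled-back form ALONG the axis: the downward segment from the reflected point. -/
theorem segUp_R1g_self (α : Fin d) (A : Form1 d R) (z : Fin d → ℤ) (n : ℕ) :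
    segUp (R1g α A) z α n = segDown A (sref α z) α n := by
  simp only [segUp, segDown, R1g_self, sref_add, axisReflect_zsmul, axisReflect_unitVec_self]
  refine List.map_congr_left fun s _ => ?_
  rw [smul_neg, add_smul, one_smul]
  congr 2
  abel

/-- [folklore] A downward segment of the pulled-back form across the axis. -/
theorem segDown_R1g_of_ne {α κ : Fin d} (h : κ ≠ α) (A : Form1 d R) (z : Fin d → ℤ) (n : ℕ) :
    segDown (R1g α A) z κ n = segDown A (sref α z) κ n := by
  simp only [segDown, R1g_of_ne h, sref_sub, axisReflect_zsmul, axisReflect_unitVec_of_ne h]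

/-- [folklore] A downward segment of the pulled-back form along the axis: the upward segment from the reflected point. -/
theorem segDown_R1g_self (α : Fin d) (A : Form1 d R) (z : Fin d → ℤ) (n : ℕ) :
    segDown (R1g α A) z α n = segUp A (sref α z) α n := by
  simp only [segUp, segDown, R1g_self, sref_sub, axisReflect_zsmul, axisReflect_unitVec_self, neg_neg]
  refine List.map_congr_left fun s _ => ?_
  rw [smul_neg, add_smul, one_smul]
  congr 2
  abel

/-- [folklore] The signed segment of the pulled-back form (length negated on the axis). -/
theorem seg_R1g (α κ : Fin d) (A : Form1 d R) (z : Fin d → ℤ) (n : ℤ) :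
    seg (R1g α A) z κ n = seg A (sref α z) κ (if κ = α then -n else n) := by
  by_cases h : κ = α
  · subst h
    simp only [if_true, seg]
    rcases lt_trichotomy n 0 with hn | rfl | hn
    · rw [if_neg (not_le.2 hn), if_pos (by omega), segDown_R1g_self]
    · simp [segUp]
    · rw [if_pos hn.le, if_neg (by omega), segUp_R1g_self, neg_neg]
  · simp only [if_neg h, seg, segUp_R1g_of_ne h, segDown_R1g_of_ne h]

/-- [folklore] The comb letters of the pulled-back form = the comb letters between the reflected endpoints. -/
theorem axialAux_R1g (α : Fin d) (A : Form1 d R) (y x : Fin d → ℤ) (m : ℕ) :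
    axialAux (R1g α A) y x m = axialAux A (sref α y) (sref α x) m := by
  induction m with
  | zero => rfl
  | succ m ih =>
    simp only [axialAux, ih, corner_sref, seg_R1g]
    congr 1
    by_cases h : m < d
    · rw [dif_pos h, dif_pos h]
      congr 1
      simp only [sref_apply, Fin.ext_iff]
      split_ifs <;> ring
    · rw [dif_neg h, dif_neg h]

/-- [folklore] THE COMB IS TRANSPORTED (generic coefficients). -/
theorem axial_R1g (α : Fin d) (A : Form1 d R) (y x : Fin d → ℤ) :
    axial (R1g α A) y x = axial A (sref α y) (sref α x) :=
  axialAux_R1g α A y x d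

/-- [folklore] TRANSPORT OF THE CENTRED `Γ` ACROSS THE AXIS (`μ ≠ α`, `L` odd), as lists, generic coefficients. -/
theorem gammaCAt_R1g_of_ne {L : ℕ} (hL : Odd L) {α μ : Fin d} (h : μ ≠ α) (A : Form1 d R) (y : Fin d → ℤ)
    {b : Fin d → ℕ} (hb : b ∈ box d L) :
    gammaCAt (ctr d L) (R1g α A) L μ y b = gammaCAt (ctr d L) A L μ (sref α y) (bflip α L b) := by
  have hr := sref_root_ctr (d := d) hL α y
  have hx := sref_block α hb y
  have he : axisReflect α ((L : ℤ) • unitVec μ) = (L : ℤ) • unitVec μ := by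
    rw [axisReflect_zsmul, axisReflect_unitVec_of_ne h]
  have hr' : sref α ((L : ℤ) • y + ctr d L + (L : ℤ) • unitVec μ) = (L : ℤ) • sref α y + ctr d L + (L : ℤ) • unitVec μ := by
    rw [sref_add, hr, he]
  have hx' : sref α ((L : ℤ) • y + toSite b + (L : ℤ) • unitVec μ)
      = (L : ℤ) • sref α y + toSite (bflip α L b) + (L : ℤ) • unitVec μ := by
    rw [sref_add, hx, he]
  simp only [gammaCAt, axial_R1g, segUp_R1g_of_ne h, hr, hx, hr', hx']

/-- [folklore] TRANSPORT OF THE CENTRED `Γ` ALONG THE AXIS (`μ = α`): the REVERSED contour of the re-based reflected bond. -/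
theorem gammaCAt_R1g_self {L : ℕ} (hL : Odd L) (α : Fin d) (A : Form1 d R) (y : Fin d → ℤ) {b : Fin d → ℕ}
    (hb : b ∈ box d L) :
    gammaCAt (ctr d L) (R1g α A) L α y b = rev (gammaCAt (ctr d L) A L α (bref α α y) (bflip α L b)) := by
  have hr := sref_root_ctr (d := d) hL α y
  have hx := sref_block α hb y
  have he : axisReflect α ((L : ℤ) • unitVec α) = -((L : ℤ) • unitVec α) := by
    rw [axisReflect_zsmul, axisReflect_unitVec_self, smul_neg]
  have p1 : sref α ((L : ℤ) • y + ctr d L) = (L : ℤ) • (sref α y - unitVec α) + ctr d L + (L : ℤ) • unitVec α := by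
    rw [hr, smul_sub]; abel
  have p2 : sref α ((L : ℤ) • y + toSite b)
      = (L : ℤ) • (sref α y - unitVec α) + toSite (bflip α L b) + (L : ℤ) • unitVec α := by
    rw [hx, smul_sub]; abel
  have p3 : sref α ((L : ℤ) • y + ctr d L + (L : ℤ) • unitVec α) = (L : ℤ) • (sref α y - unitVec α) + ctr d L := by
    rw [sref_add, hr, he, smul_sub]; abel
  have p4 : sref α ((L : ℤ) • y + toSite b + (L : ℤ) • unitVec α)
      = (L : ℤ) • (sref α y - unitVec α) + toSite (bflip α L b) := by
    rw [sref_add, hx, he, smul_sub]; abel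
  have p5 : (L : ℤ) • (sref α y - unitVec α) + toSite (bflip α L b) + (L : ℤ) • unitVec α - (L : ℤ) • unitVec α
      = (L : ℤ) • (sref α y - unitVec α) + toSite (bflip α L b) := add_sub_cancel_right _ _
  rw [bref_self, gammaCAt, gammaCAt, axial_R1g, axial_R1g, segUp_R1g_self, segDown_eq_rev_segUp, p1, p2, p3, p4, p5,
    rev_append, rev_append, rev_rev]
  simp only [List.append_assoc]

/-- [folklore] TRANSPORT OF THE CENTRED LOOP ACROSS THE AXIS (`μ ≠ α`), generic coefficients. -/
theorem loopCAt_R1g_of_ne {L : ℕ} (hL : Odd L) {α μ : Fin d} (h : μ ≠ α) (A : Form1 d R) (y : Fin d → ℤ)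
    {b : Fin d → ℕ} (hb : b ∈ box d L) :
    loopCAt (ctr d L) (R1g α A) L μ y b = loopCAt (ctr d L) A L μ (sref α y) (bflip α L b) := by
  have hr := sref_root_ctr (d := d) hL α y
  rw [loopCAt, loopCAt, gammaCAt_R1g_of_ne hL h A y hb, segUp_R1g_of_ne h, hr]

/-- [folklore] The centred closing segment ALONG the axis is transported to the REVERSED closing segment of the re-based
reflected bond `(α, bref α α y)`. -/
theorem cSeg_R1g_self {L : ℕ} (hL : Odd L) (α : Fin d) (A : Form1 d R) (y : Fin d → ℤ) :
    segUp (R1g α A) ((L : ℤ) • y + ctr d L) α L = rev (segUp A ((L : ℤ) • bref α α y + ctr d L) α L) := by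
  have hr := sref_root_ctr (d := d) hL α y
  have p1 : (L : ℤ) • sref α y + ctr d L - (L : ℤ) • unitVec α = (L : ℤ) • (sref α y - unitVec α) + ctr d L := by
    rw [smul_sub]; abel
  rw [segUp_R1g_self, segDown_eq_rev_segUp, hr, p1, bref_self]

/-- [folklore] TRANSPORT OF THE CENTRED LOOP ALONG THE AXIS (`μ = α`), written as `rev Γ′ ++ c′` over the re-based
reflected bond (`Γ′`, `c′` the centred contour and closing segment there). -/
theorem loopCAt_R1g_self' {L : ℕ} (hL : Odd L) (α : Fin d) (A : Form1 d R) (y : Fin d → ℤ) {b : Fin d → ℕ}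
    (hb : b ∈ box d L) :
    loopCAt (ctr d L) (R1g α A) L α y b = rev (gammaCAt (ctr d L) A L α (bref α α y) (bflip α L b))
      ++ segUp A ((L : ℤ) • bref α α y + ctr d L) α L := by
  rw [loopCAt, gammaCAt_R1g_self hL α A y hb, cSeg_R1g_self hL, rev_rev]

/-- [folklore] The same image loop as an5 writes it: the reversed loop of the re-based reflected bond rotated by `L`. -/
theorem loopCAt_R1g_self {L : ℕ} (hL : Odd L) (α : Fin d) (A : Form1 d R) (y : Fin d → ℤ) {b : Fin d → ℕ}
    (hb : b ∈ box d L) :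
    loopCAt (ctr d L) (R1g α A) L α y b = (rev (loopCAt (ctr d L) A L α (bref α α y) (bflip α L b))).rotate L := by
  rw [loopCAt_R1g_self' hL α A y hb, loopCAt, rev_append, rev_rev, rotate_append_of_length_eq (segUp_length _ _ _ _)]

end Generic

/-! ## §2 The letter reflection on node 12's free letter group -/

section Letters

/-- [folklore] THE LETTER REFLECTION: the additive endomorphism `δ_{(κ,x)} ↦ ± δ_{(κ, bref α κ x)}` (sign `−` iff
`κ = α`) of the free abelian group on the oriented bonds. -/
noncomputable def refL (α : Fin d) : LetterGrp d →+ LetterGrp d :=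
  Finsupp.liftAddHom fun f : Fin d × (Fin d → ℤ) =>
    zmultiplesHom (LetterGrp d) (if f.1 = α then -δ f.1 (bref α f.1 f.2) else δ f.1 (bref α f.1 f.2))

/-- [folklore] The letter reflection on a generator IS the generic signed pull-back of the universal one-form. -/
theorem refL_δ (α κ : Fin d) (x : Fin d → ℤ) : refL α (δ κ x : LetterGrp d) = R1g α δ κ x := by
  show Finsupp.liftAddHom _ (Finsupp.single (κ, x) (1 : ℤ)) = _
  rw [Finsupp.liftAddHom_apply_single, zmultiplesHom_apply, one_zsmul]
  rfl

/-- [folklore] `refL α ∘ δ = R1g α δ` as 1-forms. -/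
theorem mapForm_refL_δ (α : Fin d) : mapForm (refL α) (δ : Form1 d (LetterGrp d)) = R1g α δ := by
  funext κ x; exact refL_δ α κ x

variable {L : ℕ} (hL : Odd L)
include hL

/-- [folklore] The centred loop list of `δ`, letter-reflected, IS the centred loop list at the reflected bond (`μ ≠ α`). -/
theorem map_refL_loopCAt_of_ne {α μ : Fin d} (h : μ ≠ α) (y : Fin d → ℤ) {b : Fin d → ℕ} (hb : b ∈ box d L) :
    (loopCAt (ctr d L) δ L μ y b).map (refL α) = loopCAt (ctr d L) δ L μ (sref α y) (bflip α L b) := by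
  rw [loopCAt_map, mapForm_refL_δ, loopCAt_R1g_of_ne hL h δ y hb]

/-- [folklore] The centred closing segment of `δ`, letter-reflected (`μ ≠ α`). -/
theorem map_refL_cSeg_of_ne {α μ : Fin d} (h : μ ≠ α) (y : Fin d → ℤ) :
    (segUp δ ((L : ℤ) • y + ctr d L) μ L).map (refL α) = segUp (δ : Form1 d (LetterGrp d)) ((L : ℤ) • sref α y + ctr d L) μ L := by
  rw [segUp_map, mapForm_refL_δ, segUp_R1g_of_ne h, sref_root_ctr hL]

/-- [folklore] The centred closing segment of `δ` ALONG the axis, letter-reflected: the reversed closing segment at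
`(α, bref α α y)`. -/
theorem map_refL_cSeg_self (α : Fin d) (y : Fin d → ℤ) :
    (segUp δ ((L : ℤ) • y + ctr d L) α L).map (refL α)
      = rev (segUp (δ : Form1 d (LetterGrp d)) ((L : ℤ) • bref α α y + ctr d L) α L) := by
  rw [segUp_map, mapForm_refL_δ, cSeg_R1g_self hL]

/-- [folklore] The centred loop list of `δ` ALONG the axis, letter-reflected: `rev Γ′ ++ c′` at `(α, bref α α y)`. -/
theorem map_refL_loopCAt_self (α : Fin d) (y : Fin d → ℤ) {b : Fin d → ℕ} (hb : b ∈ box d L) :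
    (loopCAt (ctr d L) δ L α y b).map (refL α)
      = rev (gammaCAt (ctr d L) δ L α (bref α α y) (bflip α L b))
        ++ segUp (δ : Form1 d (LetterGrp d)) ((L : ℤ) • bref α α y + ctr d L) α L := by
  rw [loopCAt_map, mapForm_refL_δ, loopCAt_R1g_self' hL α δ y hb]

end Letters

end Summit.QuantumFields.BalabanUV.Beta.RootedHolonomyReflection
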